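import Summits.FinalStateConjecture.FinalStateConjecture.Theorems.PhotonSphereChannelsFrozenPacketMain
import Summits.FinalStateConjecture.FinalStateConjecture.Theorems.PhotonSphereChannelsExteriorEnergyRW

/-!
# `WindowedShellChannels` (crux stmt-FinalStateConjecture-14085, route `PhotonSphereChannels`),
# negative side — lagged apertures: monotonicity of exterior energies for apertures of any sign,
# the horizon-side bound on the `s = ℓ = 0` potential, and a bump with `∫ B′² > 0`

Helpers (everything proved, no definitions) for the load-bearing analysis of the crux by the
refuter cdisprove seat (`TravellingPacket.lean`, `FalseWithoutTwoSidedness.lean`):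

* `linePotential_zero_zero_le` — along the tortoise radius function of mass `1` centred at `0`,
  `V_{0,0}(r(x)) = (1 − 2/r)·2/r³ ≤ e^{(x+1)/2}/8` (the scalar `ℓ = 0` potential is exponentially
  small towards the horizon; from the tortoise identity `r + 2 log(r − 2) − 3 = x`);
* `exteriorEnergy_antitone_of_nonneg_edge` — for a global `C²` solution (`V ≥ 0` differentiable)
  and ANY aperture `a` (the crux uses the lagged, possibly negative aperture `ρ − h`),
  `E[ψ; {a + |t| < |x − xc|}]` is non-increasing on `{t ≥ 0, a + t ≥ 0}` (the tree's
  `RW.exteriorEnergy_antitoneOn` asks `a ≥ 0`); hence `channelEnergy_atTop_le_exteriorEnergy`: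
  the forward channel energy is at most the exterior energy at any such time;
* `exists_bump` — a `C²` bump supported in `[0, 3]` with `∫ B′² > 0`.
-/

noncomputable section

set_option linter.dupNamespace false

namespace Summit.FinalStateConjecture.FinalStateConjecture.Theorems.WindowedShellChannels.Negative

open Literature.Geometry.Lorentzian Literature.Geometry.Lorentzian.ReggeWheeler
open Summit.FinalStateConjecture.FinalStateConjecture.Theorems.Blindness
open Summit.FinalStateConjecture.FinalStateConjecture.Theorems.FrozenPacket
open Summit.FinalStateConjecture.FinalStateConjecture.Theorems.CauchyWave
open MeasureTheory Filter Set Function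
open scoped ENNReal Topology

/-! ### The `s = ℓ = 0` potential is exponentially small on the horizon side -/

/-- For the tortoise radius function of mass `1` centred at `0` (`r + 2 log(r − 2) − 3 = x`),
`V_{0,0}(r(x)) = (1 − 2/r)·2/r³ ≤ (r − 2)/8 ≤ e^{(x+1)/2}/8`. -/
theorem linePotential_zero_zero_le {r : ℝ → ℝ} (hr : IsTortoiseRadius 1 r 0) (x : ℝ) :
    linePotential 1 0 0 r x ≤ Real.exp ((x + 1) / 2) / 8 := by
  have h2 : 2 < r x := by have := hr.two_mul_lt x; linarith
  have hpos : 0 < r x := by linarith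
  have htort : tortoiseCoord 1 (r x) = x - 0 := hr.tortoiseCoord_eq x
  unfold tortoiseCoord at htort
  simp only [mul_one, Real.log_one, mul_zero, sub_zero] at htort
  -- `log (r − 2) < (x + 1)/2`
  have hlog : Real.log (r x - 2) ≤ (x + 1) / 2 := by linarith
  have hr2 : r x - 2 ≤ Real.exp ((x + 1) / 2) := by
    have h := Real.exp_le_exp.2 hlog
    rwa [Real.exp_log (by linarith)] at h
  -- the potential
  have hV : linePotential 1 0 0 r x = (1 - 2 / r x) * (2 / r x ^ 3) := by
    simp only [linePotential_apply, rwPotential]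
    push_cast
    ring
  rw [hV]
  have hfac1 : 1 - 2 / r x ≤ (r x - 2) / 2 := by
    have : 1 - 2 / r x = (r x - 2) / r x := by field_simp
    rw [this, div_le_div_iff₀ hpos (by norm_num : (0:ℝ) < 2)]
    nlinarith
  have hfac1' : 0 ≤ 1 - 2 / r x := by
    rw [sub_nonneg, div_le_one hpos]; linarith
  have hfac2 : 2 / r x ^ 3 ≤ 1 / 4 := by
    rw [div_le_div_iff₀ (by positivity) (by norm_num : (0:ℝ) < 4)]
    nlinarith [mul_pos (mul_pos hpos hpos) hpos, sq_nonneg (r x - 2)]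
  have hfac2' : 0 ≤ 2 / r x ^ 3 := by positivity
  calc (1 - 2 / r x) * (2 / r x ^ 3) ≤ (r x - 2) / 2 * (1 / 4) :=
        mul_le_mul hfac1 hfac2 hfac2' (by linarith)
    _ = (r x - 2) / 8 := by ring
    _ ≤ Real.exp ((x + 1) / 2) / 8 := by linarith

/-! ### Exterior energies with apertures of any sign -/

/-- **Monotonicity of lagged exterior energies.** For a global `C²` solution of
`ψ_tt − ψ_xx + Vψ = 0` (`V ≥ 0` differentiable), ANY aperture `a : ℝ` (negative apertures are the
lagged windows `ρ − h` of the crux) and times `0 ≤ t₁ ≤ t₂` with `0 ≤ a + t₁`: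
`exteriorEnergy V xc a ψ t₂ ≤ exteriorEnergy V xc a ψ t₁`. [folklore] -/
theorem exteriorEnergy_antitone_of_nonneg_edge {V : ℝ → ℝ} (hV : Differentiable ℝ V)
    (hV0 : ∀ x, 0 ≤ V x) {ψ : ℝ → ℝ → ℝ} (hψ : IsSolution V ψ) (xc a : ℝ) {t₁ t₂ : ℝ}
    (h1 : 0 ≤ t₁) (h12 : t₁ ≤ t₂) (ha : 0 ≤ a + t₁) :
    exteriorEnergy V xc a ψ t₂ ≤ exteriorEnergy V xc a ψ t₁ := by
  have hψ2 := hψ.1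
  have hsol' : ∀ z : ℝ × ℝ, fderiv ℝ (fderiv ℝ (Function.uncurry ψ)) z (1, 0) (1, 0)
      - fderiv ℝ (fderiv ℝ (Function.uncurry ψ)) z (0, 1) (0, 1)
      + V z.2 * Function.uncurry ψ z = 0 := by
    rintro ⟨t, x⟩
    rw [← WaveEnergy.iteratedDeriv_two_slice_fst_eq hψ2, ← WaveEnergy.iteratedDeriv_two_slice_snd_eq hψ2]
    exact hψ.2 (t, x)
  have he : ∀ z : ℝ × ℝ, (fun z : ℝ × ℝ => energyDensity V ψ z.1 z.2) z
      = (fderiv ℝ (Function.uncurry ψ) z (1, 0)) ^ 2 + (fderiv ℝ (Function.uncurry ψ) z (0, 1)) ^ 2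
        + V z.2 * Function.uncurry ψ z ^ 2 := by
    rintro ⟨t, x⟩
    simp only [Function.uncurry_apply_pair, energyDensity]
    rw [WaveEnergy.deriv_slice_fst_eq hψ2, WaveEnergy.deriv_slice_snd_eq hψ2]
  have h2 : 0 ≤ t₂ := h1.trans h12
  have hd1 : 0 ≤ a + |t₁| := by rwa [abs_of_nonneg h1]
  have hd2 : 0 ≤ a + |t₂| := by rw [abs_of_nonneg h2]; linarith
  unfold exteriorEnergy
  rw [WaveEnergy.lintegral_setOf_lt_abs_sub xc hd2, WaveEnergy.lintegral_setOf_lt_abs_sub xc hd1,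
    abs_of_nonneg h1, abs_of_nonneg h2]
  refine add_le_add ?_ ?_
  · have key := WaveEnergy.lintegral_Iio_shrinking_le hψ2 hV hV0 hsol' he (xc - (a + t₁)) h12
    have e1 : xc - (a + t₁) - (t₂ - t₁) = xc - (a + t₂) := by ring
    rw [e1] at key
    exact key
  · have key := WaveEnergy.lintegral_Ioi_shrinking_le hψ2 hV hV0 hsol' he (xc + (a + t₁)) h12
    have e1 : xc + (a + t₁) + (t₂ - t₁) = xc + (a + t₂) := by ring
    rw [e1] at key
    exact key

/-- Hence the forward channel energy of aperture `a` is at most the exterior energy at any time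
`T ≥ 0` with `a + T ≥ 0`. [folklore] -/
theorem channelEnergy_atTop_le_exteriorEnergy {V : ℝ → ℝ} (hV : Differentiable ℝ V)
    (hV0 : ∀ x, 0 ≤ V x) {ψ : ℝ → ℝ → ℝ} (hψ : IsSolution V ψ) (xc a : ℝ) {T : ℝ}
    (hT : 0 ≤ T) (ha : 0 ≤ a + T) :
    channelEnergy V xc a ψ atTop ≤ exteriorEnergy V xc a ψ T := by
  unfold channelEnergy
  refine liminf_le_of_frequently_le' (Eventually.frequently ?_)
  filter_upwards [eventually_ge_atTop T] with t ht
  exact exteriorEnergy_antitone_of_nonneg_edge hV hV0 hψ xc a hT ht ha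

/-! ### The profile -/

/-- A `C²` bump `B` supported in `[0, 3]` with `∫ B′² > 0` (the plateau bump of
`Blindness.exists_profile`: `B(0) = 0`, `B(1) = 1`, so `B′ = 1` somewhere by the mean value
theorem). -/
theorem exists_bump : ∃ B : ℝ → ℝ, ContDiff ℝ 2 B ∧ (∀ u, u ∉ Icc (0 : ℝ) 3 → B u = 0) ∧
    0 < ∫ u, deriv B u ^ 2 := by
  obtain ⟨B, hB, h0l, h0r, h1, -, -⟩ := exists_profile
  have h0 : ∀ u, u ∉ Icc (0 : ℝ) 3 → B u = 0 := by
    intro u hu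
    rcases lt_or_ge u 0 with h | h
    · exact h0l u h.le
    · have h3 : ¬ u ≤ 3 := fun h' => hu ⟨h, h'⟩
      exact h0r u (le_of_lt (lt_of_not_ge h3))
  refine ⟨B, hB, h0, ?_⟩
  -- `B′ = 1` somewhere in `(0, 1)`
  obtain ⟨ξ, -, hξ⟩ := exists_deriv_eq_slope B zero_lt_one hB.continuous.continuousOn
    ((hB.differentiable (by norm_num)).differentiableOn)
  have hB1 : B 1 = 1 := h1 1 ⟨le_rfl, by norm_num⟩
  have hB0 : B 0 = 0 := h0l 0 le_rfl
  rw [hB1, hB0] at hξ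
  norm_num at hξ
  have hc : Continuous fun u => deriv B u ^ 2 := (hB.continuous_deriv (by norm_num)).pow 2
  have hsupp : HasCompactSupport fun u => deriv B u ^ 2 := by
    refine hasCompactSupport_of_exterior (a := 0) (b := 3) fun u hu => ?_
    rw [deriv_eq_zero_off h0 hu]; ring
  exact hc.integral_pos_of_hasCompactSupport_nonneg_nonzero hsupp (fun u => sq_nonneg _)
    (x := ξ) (by rw [hξ]; norm_num)


end Summit.FinalStateConjecture.FinalStateConjecture.Theorems.WindowedShellChannels.Negative

end
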